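import Literature.MathematicalPhysics.QuantumFieldTheory.BalabanImbrieJaffe1984to88.BIJ88OrderingAnchors307

/-!
# `BalabanImbrieJaffe1984to88.BIJ88OrderingAnchorsCount307` — T. Bałaban, J. Imbrie, A. Jaffe, *Effective action and cluster properties of the
abelian Higgs model*, Commun. Math. Phys. **114** (1988) 257–315 [BalabanImbrieJaffe1988]: p. 307 [PDF 51] L14–16 (Sect. 5.13), verbatim:
*"If the walk ω(α) wanders through more than a few cubes, we begin to pickup factors e^{−cr(e_k)}."* — with [9] = J. Glimm, A. Jaffe,
T. Spencer, Part II *The cluster expansion* (Erice 1973) [GlimmJaffeSpencer1973], §8 p0234–p0236 (reprint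
`book:glimm1985-quantum-field-theory-statistical-mechanics-expositions`), verbatim: *"Let b′₂ be the first of the b's not touching b₁ = b′₁ …
a_j = Dist(b′_{j+1}, b′_j) … |ℓ| = Σ a_i"*, *"we choose the b's between b′₁ and b′₂ in O(1) ways, since they all must overlap b₁"*, and (8.8):
*"If |ℓ| ≥ 1 for all ℓ ∈ L(γ), then we can include a factor m₀^{−|γ|}"* — **THE ANCHOR LENGTH GROWS LINEARLY WITH THE NUMBER OF BOUNDARIES:
A SMALL FACTOR PER BOUNDARY BEYOND THE FIRST FEW**.

Two counting facts about [9]'s anchors (`BIJ88OrderingAnchors307`) that turn the decay `e^{−λ|ℓ|}` of the train-level letter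
(`BIJ88TrainDecayLetter309`) into print's *"factors e^{−cr(e_k)}"* per cube wandered through (GAPS G-C2-p36-10 ADDENDUM 7 item (a)):
* §1 **`length_add_le_of_anchorsFrom`**, **`length_le_mul_length_anchors`** — every boundary of an ordering without repetitions touches the
  anchor preceding it, so if no boundary touches more than `c₀` boundaries of the ordering, `|ℓ|_{list} ≤ (c₀+1)·#anchors(ℓ)`
  (*"they all must overlap b₁"*);
* §2 **`mul_length_anchorsFrom_le`**, **`mul_length_anchors_le`** — consecutive anchors do not touch, so if non-touching boundaries are `≥ r₁`
  apart, `r₁·(#anchors(ℓ) − 1) ≤ |ℓ|`;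
* §3 **`exp_neg_anchorLen_le_pow`** — hence `e^{−λ|ℓ|} ≤ e^{λr₁}·(e^{−λr₁/(c₀+1)})^{length ℓ}`: a fixed small factor PER BOUNDARY of the train
  (p. 307: per cube *"wander[ed] through"*, beyond *"a few"*).

statement-level skeleton of published theorems with citation tags; proofs where landed; nothing here is a claim about the Yang–Mills mass gap

PDF held: `paper:balaban1988-cmp114-bij-abelian-higgs-effective-action` p. 307 (p0051 L14–16); [9] reprint
`book:glimm1985-quantum-field-theory-statistical-mechanics-expositions` p0234–p0236 re-read this session as text.

CITATION HEADER (lean-in-tree rule).  Part of the lit-balaban TYPED SKELETON (HOME `run/shared/lean/pub/lit-balaban/`), Phase 2, seat p36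
(gen 23, unit `lit-balaban-p36`); rows **C2.Eq5.14.3-5.14.4** (member: size-free road, assembly item (a)) and C2.Eq5.13.3-5.13.4 (member) of
`HOME/lit-balaban-r16/ROWS-C2-part2.md` (owner r16, referee ref-5).  Theorem-only (lists over an abstract type); no definitions, no `Prop` facts;
axioms standard.  HONEST SCOPE: counting only; the touching-degree `c₀` and separation `r₁` are the reader's letters on the cube geometry.  NOT summit
progress; NOT continuum; NOT Clay.
-/

namespace Literature.MathematicalPhysics.QuantumFieldTheory.BalabanImbrieJaffe1984to88.BIJ88OrderingAnchorsCount307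

open BIJ88OrderingAnchors307 (anchorsFrom anchors anchorLenFrom anchorLen anchorsFrom_cons anchorLenFrom_cons anchorLen_cons)

variable {β : Type*} (touch : β → β → Prop) [DecidableRel touch] (D : β → β → ℝ)

/-! ## §1  Every boundary touches the anchor before it: `|ℓ| ≤ (c₀+1)·#anchors` -/

/-- the anchored scan with a budget: if at most `c₀ − j` boundaries of `t` touch the current anchor `b` and at most `c₀` touch any other boundary,
then `|t| + j ≤ c₀ + (c₀+1)·#anchorsFrom b t` (*"we choose the b's between b′₁ and b′₂ in O(1) ways, since they all must overlap b₁"*).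
[cite: GlimmJaffeSpencer1973, Prop. 8.2 (8.11) p0235–p0236] -/
theorem length_add_le_of_anchorsFrom {c₀ : ℕ} :
    ∀ (t : List β) (b : β) (j : ℕ), (t.filter fun u => touch b u).length + j ≤ c₀ →
      (∀ b' ∈ t, (t.filter fun u => touch b' u).length ≤ c₀) →
      t.length + j ≤ c₀ + (c₀ + 1) * (anchorsFrom touch b t).length
  | [], b, j, hj, _ => by simpa [anchorsFrom] using hj
  | u :: t, b, j, hj, hall => by
    have hall' : ∀ b' ∈ t, (t.filter fun u => touch b' u).length ≤ c₀ := fun b' hb' =>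
      le_trans (by rw [List.filter_cons]; split_ifs <;> simp) (hall b' (List.mem_cons_of_mem u hb'))
    rw [anchorsFrom_cons]
    split_ifs with hbu
    · -- `u` touches `b`: one unit of the budget is spent
      have hj' : (t.filter fun u => touch b u).length + (j + 1) ≤ c₀ := by
        rw [List.filter_cons, if_pos (by simpa using hbu)] at hj
        simp only [List.length_cons] at hj
        omega
      have h := length_add_le_of_anchorsFrom t b (j + 1) hj' hall'
      simp only [List.length_cons]
      omega
    · -- `u` is the next anchor: fresh budget `c₀` at `u`
      have hu : (t.filter fun u' => touch u u').length + 0 ≤ c₀ := by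
        have h1 := hall u List.mem_cons_self
        rw [List.filter_cons] at h1
        split_ifs at h1 <;> simp only [List.length_cons, add_zero] at h1 ⊢ <;> omega
      have h := length_add_le_of_anchorsFrom t u 0 hu hall'
      have hjc : j ≤ c₀ := le_trans (Nat.le_add_left j _) hj
      simp only [List.length_cons]
      nlinarith [h, hjc]

/-- **`|ℓ| ≤ (c₀+1)·#anchors(ℓ)`** when no boundary of the ordering touches more than `c₀` of its boundaries (the touching degree of the cube
geometry; an ordering has no repetitions). [cite: GlimmJaffeSpencer1973, Prop. 8.2 (8.11) p0235–p0236] [cite: BalabanImbrieJaffe1988, §5.13 p.307 L14–16] -/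
theorem length_le_mul_length_anchors {c₀ : ℕ} (ℓ : List β) (hdeg : ∀ b' ∈ ℓ, (ℓ.filter fun u => touch b' u).length ≤ c₀) :
    ℓ.length ≤ (c₀ + 1) * (anchors touch ℓ).length := by
  cases ℓ with
  | nil => simp
  | cons b t =>
    have hall' : ∀ b' ∈ t, (t.filter fun u => touch b' u).length ≤ c₀ := fun b' hb' =>
      le_trans (by rw [List.filter_cons]; split_ifs <;> simp) (hdeg b' (List.mem_cons_of_mem b hb'))
    have hb : (t.filter fun u => touch b u).length + 0 ≤ c₀ := by
      have h1 := hdeg b List.mem_cons_self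
      rw [List.filter_cons] at h1
      split_ifs at h1 <;> simp only [List.length_cons, add_zero] at h1 ⊢ <;> omega
    have h := length_add_le_of_anchorsFrom touch t b 0 hb hall'
    show t.length + 1 ≤ (c₀ + 1) * ((anchorsFrom touch b t).length + 1)
    nlinarith [h]

/-! ## §2  Consecutive anchors do not touch: `r₁·(#anchors − 1) ≤ |ℓ|` -/

/-- the anchored scan: `r₁·#anchorsFrom b t ≤ anchorLenFrom b t` when non-touching pairs are `≥ r₁` apart (each new anchor does not touch the
previous one and contributes `a_j = D(b′_j, b′_{j+1}) ≥ r₁`; [9] (8.8): *"If |ℓ| ≥ 1 for all ℓ"* — non-touching lattice lines are `≥ 1` apart).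
[cite: GlimmJaffeSpencer1973, §8 (8.8) p0234–p0235] -/
theorem mul_length_anchorsFrom_le {r₁ : ℝ} (hsep : ∀ b u, ¬touch b u → r₁ ≤ D b u) :
    ∀ (t : List β) (b : β), r₁ * (anchorsFrom touch b t).length ≤ anchorLenFrom touch D b t
  | [], b => by simp [anchorsFrom, anchorLenFrom]
  | u :: t, b => by
    rw [anchorsFrom_cons, anchorLenFrom_cons]
    split_ifs with hbu
    · exact mul_length_anchorsFrom_le hsep t b
    · have h := mul_length_anchorsFrom_le hsep t u
      simp only [List.length_cons, Nat.cast_succ]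
      linarith [hsep b u hbu]

/-- **`r₁·(#anchors(ℓ) − 1) ≤ |ℓ|`** for a nonempty ordering, when non-touching boundaries are `≥ r₁` apart.
[cite: GlimmJaffeSpencer1973, §8 (8.8) p0234–p0235] [cite: BalabanImbrieJaffe1988, §5.13 p.307 L14–16] -/
theorem mul_length_anchors_le {r₁ : ℝ} (hsep : ∀ b u, ¬touch b u → r₁ ≤ D b u) (b : β) (t : List β) :
    r₁ * ((anchors touch (b :: t)).length - 1 : ℝ) ≤ anchorLen touch D (b :: t) := by
  have h := mul_length_anchorsFrom_le touch D hsep t b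
  have h1 : ((anchors touch (b :: t)).length : ℝ) - 1 = (anchorsFrom touch b t).length := by
    show (((b :: anchorsFrom touch b t).length : ℕ) : ℝ) - 1 = _
    simp
  rw [h1, anchorLen_cons]
  exact h

/-! ## §3  A small factor per boundary -/

/-- **A SMALL FACTOR PER BOUNDARY OF THE TRAIN**: under the touching-degree letter `c₀` and the separation letter `r₁ ≥ 0` of §1–§2, for every
nonempty ordering `ℓ` without repetitions of its boundaries and `λ ≥ 0`:
`e^{−λ|ℓ|} ≤ e^{λr₁}·(e^{−λr₁/(c₀+1)})^{length ℓ}` — p. 307: *"If the walk ω(α) wanders through more than a few cubes, we begin to pickup factors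
e^{−cr(e_k)}"*, with *"a few"* = the `c₀ + 1` boundaries a single anchor can account for. [cite: BalabanImbrieJaffe1988, §5.13 p.307 L14–16]
[cite: GlimmJaffeSpencer1973, §8 (8.8), Prop. 8.2 (8.11)] -/
theorem exp_neg_anchorLen_le_pow {c₀ : ℕ} {r₁ lam : ℝ} (hr₁ : 0 ≤ r₁) (hlam : 0 ≤ lam) (hsep : ∀ b u, ¬touch b u → r₁ ≤ D b u)
    (b : β) (t : List β) (hdeg : ∀ b' ∈ b :: t, ((b :: t).filter fun u => touch b' u).length ≤ c₀) :
    Real.exp (-(lam * anchorLen touch D (b :: t))) ≤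
      Real.exp (lam * r₁) * Real.exp (-(lam * r₁ / (c₀ + 1))) ^ (b :: t).length := by
  have h1 := mul_length_anchors_le touch D hsep b t
  have h2 := length_le_mul_length_anchors touch (b :: t) hdeg
  have h2' : ((b :: t).length : ℝ) ≤ (c₀ + 1) * ((anchors touch (b :: t)).length : ℝ) := by exact_mod_cast h2
  have hc : (0 : ℝ) < c₀ + 1 := by positivity
  rw [← Real.exp_nat_mul, ← Real.exp_add]
  refine Real.exp_le_exp.2 ?_
  -- `−λ|ℓ| ≤ λr₁ − λr₁·length/(c₀+1)` from `r₁(#anchors − 1) ≤ |ℓ|` and `length ≤ (c₀+1)#anchors`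
  have h3 : lam * r₁ * (((b :: t).length : ℝ) / (c₀ + 1)) ≤ lam * r₁ * ((anchors touch (b :: t)).length : ℝ) := by
    refine mul_le_mul_of_nonneg_left ?_ (mul_nonneg hlam hr₁)
    rw [div_le_iff₀ hc]
    linarith
  have h4 : lam * (r₁ * (((anchors touch (b :: t)).length : ℝ) - 1)) ≤ lam * anchorLen touch D (b :: t) :=
    mul_le_mul_of_nonneg_left h1 hlam
  have h5 : ((b :: t).length : ℝ) * -(lam * r₁ / (c₀ + 1)) = -(lam * r₁ * (((b :: t).length : ℝ) / (c₀ + 1))) := by ring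
  rw [h5]
  linarith

end Literature.MathematicalPhysics.QuantumFieldTheory.BalabanImbrieJaffe1984to88.BIJ88OrderingAnchorsCount307
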